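import Summits.BirchSwinnertonDyer.BirchSwinnertonDyer.Theorems.ManinLocalTwoThreeRigidityImpliesTower
import Summits.BirchSwinnertonDyer.BirchSwinnertonDyer.Theorems.ManinLocalTwoThreeShimuraIndexKatz
import HarnessLib

/-!
# UNIT TWISTS IN THE `q`-TOWER — non-vanishing mod `p` of `L(W, χ, 1)/Ω⁺` for even characters of `q`-power conductor, for every
# elliptic curve whose plus index is prime to `p`: `W[p]` irreducible · the `ℚ`-isogeny class `p`-torsion-free · `p ≥ 11` (Mazur) ·
# a second additive prime · a multiplicative prime `ℓ` with `p ∤ a_ℓ − ℓ` (cell bsd-f2-manin; prover seat bsd-line-manin23-p2 gen 11)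

Summit `BirchSwinnertonDyer`, route `ManinLocalTwoThree`, cruxes C3 `ManinPrimeToThreeAtNine` (stmt-BirchSwinnertonDyer-22968) / C2
`ManinOddAtFour` (stmt-…-22967).  `…RigidityImpliesTower.exists_primitive_even_unitTwistAt` (p679277) proves E-an-135 for every
prime `p`: for the newform `f` of `W` with `PlusIndexPrimeTo p f`, every odd prime `q ≠ p`, `q ∤ N`, `p ∤ (q−1)/2`, and every `n₁`,
some primitive even `χ` of conductor `qⁿ`, `n ≥ n₁`, has `UnitTwistAt p W f χ` — the Euler-symmetrised twisted symbol sum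
`e_S(χ)·Σ_a χ(a){∞,a/qⁿ}_f` is `r·Ω⁺_f` with `s·r/p` never an algebraic integer (`p ∤ s`), i.e. the algebraic part of `L(W, χ̄, 1)` is a
`p`-adic UNIT.  This file discharges the plus-index hypothesis by the tree's Shimura-index theorems, giving CURVE-LEVEL statements:

* `exists_primitive_even_unitTwistAt_of_hasIrreducibleModPGaloisRep` — `W[p]` irreducible (Ribet's Eisenstein congruence + Chebotarev,
  tree `plusIndexPrimeTo_of_hasIrreducibleModPGaloisRep`); the `p = 3` / `p = 2` instances `…_of_forall_not_isRoot_Ψ₃`,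
  `…_of_noRationalTwoTorsion`;
* `exists_primitive_even_unitTwistAt_of_forall_isogeny_addOrderOf_ne` — no rational `p`-torsion up to `p`-isogeny (Katz);
* `exists_primitive_even_unitTwistAt_of_eleven_le` — every `p ≥ 11`, CONDITIONAL on Mazur's torsion theorem `mazur_torsion` (named fact);
* `exists_primitive_even_unitTwistAt_of_sq_dvd` — a second additive prime `ℓ ≠ p` (`ℓ² ∣ N`; traceless sieve);
* `exists_primitive_even_unitTwistAt_of_not_dvd_lFunction_sub` — a prime `ℓ ∣ N` with `p ∤ a_ℓ(W) − ℓ` (THEOREM W sieve).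

HONEST FRAMING: theorems about the tree's modular-symbol / `UnitTwistAt` vocabulary for a GIVEN newform datum (`IsNewformOf W f` is a
hypothesis — modularity is not asserted); prior art of the same shape: Ash–Stevens (Duke 53, 1986), Stevens 1985, Kim–Sun (ℓ-power
twists under irreducible `ρ̄`) — placement is the cell referee's (REF1 §R98 flag).  Nothing about Manin's conjecture or BSD is asserted.
No definitions, no named facts, no sorry.
-/

set_option autoImplicit false
set_option linter.dupNamespace false

noncomputable section

open scoped Classical MatrixGroups ModularForm

open CongruenceSubgroup Complex WeierstrassCurve Literature.NumberTheory.EllipticCurves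
  Literature.NumberTheory.EllipticCurves.ModularForms
open Summit.BirchSwinnertonDyer.Rank1Residual.ManinAdditive.KatoCurve

namespace Summit.BirchSwinnertonDyer.BirchSwinnertonDyer.Theorems.ManinLocalTwoThree

variable (W : WeierstrassCurve ℚ) [W.IsElliptic] [W.IsGloballyMinimal] {N : ℕ} [NeZero N]

/-- **Unit twists in the `q`-tower when `W[p]` is irreducible.**  For the newform `f` of a globally minimal elliptic `W/ℚ`, a prime `p`
with `W[p]` an irreducible Galois module, an odd prime `q ≠ p`, `q ∤ N`, `p ∤ (q−1)/2`, and every `n₁`: some PRIMITIVE EVEN Dirichlet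
character `χ` of conductor `qⁿ`, `n ≥ n₁`, has `UnitTwistAt p W f χ`. [cite: Ribet1988Shimura, Thm. 1 and §3] -/
theorem exists_primitive_even_unitTwistAt_of_hasIrreducibleModPGaloisRep {p : ℕ} (hp : p.Prime)
    (f : CuspForm (Gamma0 N) 2) (hWf : IsNewformOf W f) (hirr : W.HasIrreducibleModPGaloisRep p)
    (q : ℕ) [Fact q.Prime] (hq3 : 3 ≤ q) (hqp : q ≠ p) (hqN : ¬ q ∣ N) (hpdiv : ¬ p ∣ (q - 1) / 2) (n₁ : ℕ) :
    ∃ n : ℕ, n₁ ≤ n ∧ ∃ χ : DirichletCharacter ℂ (q ^ n), χ.IsPrimitive ∧ χ.Even ∧ UnitTwistAt p W f χ :=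
  exists_primitive_even_unitTwistAt hp W f hWf (plusIndexPrimeTo_of_hasIrreducibleModPGaloisRep W hWf hp hirr)
    q hq3 hqp hqN hpdiv n₁

/-- **`p = 3`: `Ψ₃` without a rational root** (⟺ `W[3]` irreducible) ⟹ unit twists mod `3` in every admissible `q`-tower
(`q` odd prime, `q ≠ 3`, `q ∤ N`, `3 ∤ (q−1)/2`, i.e. `q ≡ 2 (mod 3)`). [cite: Cremona1997, §3.8 (l = 3)] -/
theorem exists_primitive_even_unitTwistAt_three_of_forall_not_isRoot_Ψ₃
    (f : CuspForm (Gamma0 N) 2) (hWf : IsNewformOf W f) (hΨ : ∀ x₀ : ℚ, ¬ W.Ψ₃.IsRoot x₀)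
    (q : ℕ) [Fact q.Prime] (hq3 : 3 < q) (hqN : ¬ q ∣ N) (hpdiv : ¬ 3 ∣ (q - 1) / 2) (n₁ : ℕ) :
    ∃ n : ℕ, n₁ ≤ n ∧ ∃ χ : DirichletCharacter ℂ (q ^ n), χ.IsPrimitive ∧ χ.Even ∧ UnitTwistAt 3 W f χ :=
  exists_primitive_even_unitTwistAt_of_hasIrreducibleModPGaloisRep W Nat.prime_three f hWf
    ((W.hasIrreducibleModPGaloisRep_three_iff_forall_not_isRoot_Ψ₃).mpr hΨ) q hq3.le (by omega) hqN hpdiv n₁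

/-- **`p = 2`: no rational `2`-torsion** (⟺ `W[2]` irreducible) ⟹ unit twists mod `2` in every admissible `q`-tower
(`q` odd prime, `q ∤ N`, `2 ∤ (q−1)/2`, i.e. `q ≡ 3 (mod 4)`). [cite: Ribet1988Shimura, Thm. 1 and §3] -/
theorem exists_primitive_even_unitTwistAt_two_of_noRationalTwoTorsion
    (f : CuspForm (Gamma0 N) 2) (hWf : IsNewformOf W f) (hT : ∀ e : ℚ, ¬ W.twoTorsionPolynomial.toPoly.IsRoot e)
    (q : ℕ) [Fact q.Prime] (hq3 : 3 ≤ q) (hqN : ¬ q ∣ N) (hpdiv : ¬ 2 ∣ (q - 1) / 2) (n₁ : ℕ) :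
    ∃ n : ℕ, n₁ ≤ n ∧ ∃ χ : DirichletCharacter ℂ (q ^ n), χ.IsPrimitive ∧ χ.Even ∧ UnitTwistAt 2 W f χ := by
  refine exists_primitive_even_unitTwistAt_of_hasIrreducibleModPGaloisRep W Nat.prime_two f hWf ?_ q hq3 (by omega) hqN hpdiv n₁
  by_contra hred
  obtain ⟨e, he⟩ := (W.not_hasIrreducibleModPGaloisRep_two_iff_exists_isRoot_twoTorsionPolynomial).mp hred
  exact hT e he

/-- **No rational `p`-torsion up to `p`-isogeny** (no curve `ℚ`-isogenous to `W` by an isogeny of degree dividing `p` has a rational point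
of order `p`) ⟹ unit twists mod `p` in every admissible `q`-tower. [cite: Katz1980, Thm. 2 (m = ℓ)] -/
theorem exists_primitive_even_unitTwistAt_of_forall_isogeny_addOrderOf_ne {p : ℕ} (hp : p.Prime)
    (f : CuspForm (Gamma0 N) 2) (hWf : IsNewformOf W f)
    (h : ∀ (W' : WeierstrassCurve ℚ) [W'.IsElliptic] (g : Isogeny W W'), g.degree ∣ p →
      ∀ Q : W'.toAffine.Point, addOrderOf Q ≠ p)
    (q : ℕ) [Fact q.Prime] (hq3 : 3 ≤ q) (hqp : q ≠ p) (hqN : ¬ q ∣ N) (hpdiv : ¬ p ∣ (q - 1) / 2) (n₁ : ℕ) :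
    ∃ n : ℕ, n₁ ≤ n ∧ ∃ χ : DirichletCharacter ℂ (q ^ n), χ.IsPrimitive ∧ χ.Even ∧ UnitTwistAt p W f χ :=
  exists_primitive_even_unitTwistAt hp W f hWf
    (plusIndexPrimeTo_of_shimuraIndexPrimeTo hp f (shimuraIndexPrimeTo_of_forall_isogeny_addOrderOf_ne W hWf hp h))
    q hq3 hqp hqN hpdiv n₁

/-- **Every prime `p ≥ 11`** ⟹ unit twists mod `p` in every admissible `q`-tower — CONDITIONAL on Mazur's torsion theorem (the named
Literature fact `mazur_torsion`, taken as a hypothesis for all curves). [cite: Mazur1977, Thm. (8)] [cite: Katz1980, Thm. 2 (m = ℓ)] -/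
theorem exists_primitive_even_unitTwistAt_of_eleven_le (hMT : ∀ V : WeierstrassCurve ℚ, mazur_torsion V) {p : ℕ} (hp : p.Prime)
    (h11 : 11 ≤ p) (f : CuspForm (Gamma0 N) 2) (hWf : IsNewformOf W f)
    (q : ℕ) [Fact q.Prime] (hq3 : 3 ≤ q) (hqp : q ≠ p) (hqN : ¬ q ∣ N) (hpdiv : ¬ p ∣ (q - 1) / 2) (n₁ : ℕ) :
    ∃ n : ℕ, n₁ ≤ n ∧ ∃ χ : DirichletCharacter ℂ (q ^ n), χ.IsPrimitive ∧ χ.Even ∧ UnitTwistAt p W f χ :=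
  exists_primitive_even_unitTwistAt hp W f hWf
    (plusIndexPrimeTo_of_shimuraIndexPrimeTo hp f (shimuraIndexPrimeTo_of_eleven_le_of_mazur_torsion W hMT hWf hp h11))
    q hq3 hqp hqN hpdiv n₁

omit [W.IsGloballyMinimal] in
/-- **A second additive prime `ℓ ≠ p`** (`ℓ² ∣ N`; the traceless sieve `plusIndexPrimeTo_of_sq_dvd`) ⟹ unit twists mod `p` in every
admissible `q`-tower. [cite: LingOesterle1991, §1] -/
theorem exists_primitive_even_unitTwistAt_of_sq_dvd {p : ℕ} (hp : p.Prime)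
    (f : CuspForm (Gamma0 N) 2) (hWf : IsNewformOf W f) {ℓ : ℕ} (hℓ : ℓ.Prime) (hℓN : ℓ ^ 2 ∣ N) (hpℓ : ¬ p ∣ ℓ)
    (q : ℕ) [Fact q.Prime] (hq3 : 3 ≤ q) (hqp : q ≠ p) (hqN : ¬ q ∣ N) (hpdiv : ¬ p ∣ (q - 1) / 2) (n₁ : ℕ) :
    ∃ n : ℕ, n₁ ≤ n ∧ ∃ χ : DirichletCharacter ℂ (q ^ n), χ.IsPrimitive ∧ χ.Even ∧ UnitTwistAt p W f χ :=
  exists_primitive_even_unitTwistAt hp W f hWf (plusIndexPrimeTo_of_sq_dvd hWf.1 hℓ hℓN hpℓ) q hq3 hqp hqN hpdiv n₁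

omit [W.IsGloballyMinimal] in
/-- **A prime `ℓ ∣ N` with `p ∤ a_ℓ(W) − ℓ`** (THEOREM W sieve `plusIndexPrimeTo_of_heckeT_eigen`: `T_ℓ ≡ ℓ` on the Shimura quotient) ⟹
unit twists mod `p` in every admissible `q`-tower. [cite: LingOesterle1991, Thm. «T_p = p on Σ(N)»] -/
theorem exists_primitive_even_unitTwistAt_of_not_dvd_lFunction_sub {p : ℕ} (hp : p.Prime)
    (f : CuspForm (Gamma0 N) 2) (hWf : IsNewformOf W f) {ℓ : ℕ} (hℓ : ℓ.Prime) (hℓN : ℓ ∣ N)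
    (hpa : ¬ (p : ℤ) ∣ W.LFunction ℓ - ℓ)
    (q : ℕ) [Fact q.Prime] (hq3 : 3 ≤ q) (hqp : q ≠ p) (hqN : ¬ q ∣ N) (hpdiv : ¬ p ∣ (q - 1) / 2) (n₁ : ℕ) :
    ∃ n : ℕ, n₁ ≤ n ∧ ∃ χ : DirichletCharacter ℂ (q ^ n), χ.IsPrimitive ∧ χ.Even ∧ UnitTwistAt p W f χ := by
  haveI : NeZero ℓ := ⟨hℓ.ne_zero⟩
  have hT : heckeT (Gamma0 N) 2 ℓ f = ((W.LFunction ℓ : ℤ) : ℂ) • f := by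
    rw [hWf.1.heckeT_eq_coeff_smul hℓ]
    have h2 : cuspCoeff f ℓ = ((W.LFunction ℓ : ℤ) : ℂ) := hWf.2 ℓ
    exact congrArg (· • f) h2
  exact exists_primitive_even_unitTwistAt hp W f hWf (plusIndexPrimeTo_of_heckeT_eigen f hℓ hℓN hT hpa) q hq3 hqp hqN hpdiv n₁

end Summit.BirchSwinnertonDyer.BirchSwinnertonDyer.Theorems.ManinLocalTwoThree

end
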